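import Mathlib
import HarnessLib
import Summits.NavierStokesRegularity.NavierStokesRegularity.Theorems.TaylorModelRungThreeCertificateFormat
import Summits.NavierStokesRegularity.NavierStokesRegularity.Theorems.TaylorModelRungThreeCertificateCompact
import Summits.NavierStokesRegularity.NavierStokesRegularity.Theorems.TaylorModelRungThreeCertificateScalar

/-!
# Crux K1b-DR (stmt-NavierStokesRegularity-23954), line `taylor-model` — ARRAY-CODED twins of the certificate tables and of
# the `Chain` checker (dss_58 (A) (i); S1-VECTOR-23954 §5.2/§5.6)

The format of record (`CertTables`, p602753) codes vectors, matrices and the coefficient table as `List`s read through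
`List.getD` — O(index) per access, so that the KERNEL evaluates small certificates by `decide`; measured (K-SIZE-23954-v2,
S1-VECTOR §5): at n = 24…88 window coordinates one node does not replay in 600 s, while the same arithmetic ARRAY-coded
runs in seconds. This module is the array-coded twin used for COMPILED replay (`native_decide`): records `NodeTablesA`,
`StageTablesA`, `CertTablesA` (same fields, `Array`-typed), the conversion `CertTablesA.toLists : CertTablesA K → CertTables K`
back to the format of record (the SEMANTICS `toCertData` stays on the list side and is never evaluated at size), array
primitives mirroring the list ones ONE-TO-ONE (`vgetA`, `mgetA`, `Array.ofFn` in place of `List.range … |>.map`, same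
`sumN`/`dotN`/`allN` loops), the array field `qTvecA`/`QbVecA`/`symQbMatA`, and the checkers `checkNodeA`, `checkStepA`,
`checkChainStageA`, `checkChainA` (tails / entry / coefficient twins follow in the companion file); plus
`CertTablesC.expandA` (the compact input expanded with array jets). The extensional-equality theorems `checkNodeA = checkNode ∘ toLists` etc. (so
that every landed soundness theorem transfers by rewriting) are the subject of the companion file
`…CertificateArrayEq`; this file only DEFINES (evaluation at size = compiled replay, companion timing file). MODEL-lattice rung TL-M3; nothing here is a statement about the Navier–Stokes equations.
-/

-- the sub-problem namespace repeats the summit name by design (D-0017)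
set_option linter.dupNamespace false

namespace Summit.NavierStokesRegularity.NavierStokesRegularity.Theorems.TaylorModelCert

open Literature.Analysis.FluidPDE.TaoCascade Literature.Analysis.FluidPDE.TaoCascade.TaylorChain

/-! ### Array primitives (mirror `vget`/`mget`/`mulVecN`/… of the format file, O(1) indexing) -/

section ArrOps

variable {K : Type} [Field K]

/-- Entry `c` of an array-coded vector (junk `0`). [folklore] -/
def vgetA (v : Array K) (c : ℕ) : K := v.getD c 0

/-- Entry `(r, c)` of an array-coded matrix (junk `0`). [folklore] -/
def mgetA (A : Array (Array K)) (r c : ℕ) : K := (A.getD r #[]).getD c 0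

/-- Matrix–vector product, array-coded, size `n`. [folklore] -/
def mulVecA (n : ℕ) (A : Array (Array K)) (v : Array K) : Array K :=
  Array.ofFn (n := n) fun r => dotN n (mgetA A r) (vgetA v)

/-- Matrix product, array-coded, size `n`. [folklore] -/
def mulMatA (n : ℕ) (A B : Array (Array K)) : Array (Array K) :=
  Array.ofFn (n := n) fun r => Array.ofFn (n := n) fun c => dotN n (mgetA A r) (fun t => mgetA B t c)

/-- Pointwise sum of array-coded vectors. [folklore] -/
def addVecA (n : ℕ) (u v : Array K) : Array K := Array.ofFn (n := n) fun c => vgetA u c + vgetA v c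

/-- Pointwise sum of array-coded matrices. [folklore] -/
def addMatA (n : ℕ) (A B : Array (Array K)) : Array (Array K) :=
  Array.ofFn (n := n) fun r => Array.ofFn (n := n) fun c => mgetA A r c + mgetA B r c

/-- Scalar multiple of an array-coded matrix. [folklore] -/
def smulMatA (n : ℕ) (a : K) (A : Array (Array K)) : Array (Array K) :=
  Array.ofFn (n := n) fun r => Array.ofFn (n := n) fun c => a * mgetA A r c

/-- Zero vector of size `n`. [folklore] -/
def zeroVecA (n : ℕ) : Array K := Array.ofFn (n := n) fun _ => (0 : K)

/-- Zero matrix of size `n`. [folklore] -/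
def zeroMatA (n : ℕ) : Array (Array K) := Array.ofFn (n := n) fun _ => Array.ofFn (n := n) fun _ => (0 : K)

end ArrOps

/-! ### Array-coded tables -/

/-- Per-node tables, array-coded (fields as `NodeTables`). [folklore] -/
structure NodeTablesA (K : Type) where
  (Tn mC EI E EO ρ ρO NCi : K)
  x : Array K
  P : Array (Array K)
  rP : Array K
  (Cm Ci : Array (Array K))
  W : Array (Array (Array K))

/-- Per-stage tables, array-coded (fields as `StageTables`). [folklore] -/
structure StageTablesA (K : Type) where
  S : ℕ
  ω : Array K
  (bb κ Λ δ Lv as γ Nσ lev dm ΛX : K)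
  nx : ℕ
  ell : Array (Array K)
  (ctr rad s β NDL : Array K)
  σf : Array K
  nodes : Array (NodeTablesA K)
  steps : Array (StepTables K)

/-- Certificate tables, array-coded (fields as `CertTables`). [folklore] -/
structure CertTablesA (K : Type) where
  (Kb Ka : ℤ)
  (pdeg N₀ : ℕ)
  (R θ c η₀ Cb Cg τs mm : K)
  i₀ : Fin 4
  X₀ : Array K
  (M W : Array K)
  α : Array K
  coef : Array K
  stages : Array (StageTablesA K)

/-- Entry proof data, array-coded (`[j][c][l]`). [folklore] -/
structure EntryAuxA (K : Type) where
  lamCi : Array (Array (Array K))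
  lamId : Array (Array (Array K))

namespace NodeTablesA

/-- Back to the list-coded node record of the format file. [folklore] -/
def toLists {K : Type} (N : NodeTablesA K) : NodeTables K :=
  { Tn := N.Tn, mC := N.mC, EI := N.EI, E := N.E, EO := N.EO, ρ := N.ρ, ρO := N.ρO, NCi := N.NCi, x := N.x.toList,
    P := (N.P.map Array.toList).toList, rP := N.rP.toList, Cm := (N.Cm.map Array.toList).toList,
    Ci := (N.Ci.map Array.toList).toList, W := (N.W.map fun M => (M.map Array.toList).toList).toList }

end NodeTablesA

namespace StageTablesA

/-- Back to the list-coded stage record. [folklore] -/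
def toLists {K : Type} (G : StageTablesA K) : StageTables K :=
  { S := G.S, ω := G.ω.toList, bb := G.bb, κ := G.κ, Λ := G.Λ, δ := G.δ, Lv := G.Lv, as := G.as, γ := G.γ, Nσ := G.Nσ,
    lev := G.lev, dm := G.dm, ΛX := G.ΛX, nx := G.nx, ell := (G.ell.map Array.toList).toList, ctr := G.ctr.toList,
    rad := G.rad.toList, s := G.s.toList, β := G.β.toList, NDL := G.NDL.toList, σf := G.σf.toList,
    nodes := (G.nodes.map NodeTablesA.toLists).toList, steps := G.steps.toList }

end StageTablesA

namespace EntryAuxA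

/-- Back to the list-coded entry data. [folklore] -/
def toLists {K : Type} (E : EntryAuxA K) : EntryAux K :=
  { lamCi := (E.lamCi.map fun X => (X.map Array.toList).toList).toList,
    lamId := (E.lamId.map fun X => (X.map Array.toList).toList).toList }

end EntryAuxA

namespace CertTablesA

variable {K : Type} [Field K] [LinearOrder K]

/-- **Back to the format of record** (`CertTables`, list-coded): the semantics `toCertData` is taken there. [folklore] -/
def toLists (T : CertTablesA K) : CertTables K :=
  { Kb := T.Kb, Ka := T.Ka, pdeg := T.pdeg, N₀ := T.N₀, R := T.R, θ := T.θ, c := T.c, η₀ := T.η₀, Cb := T.Cb, Cg := T.Cg,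
    τs := T.τs, mm := T.mm, i₀ := T.i₀, X₀ := T.X₀.toList, M := T.M.toList, W := T.W.toList, α := T.α.toList,
    coef := T.coef.toList, stages := (T.stages.map StageTablesA.toLists).toList }

/-- Number of window shells. [folklore] -/
def m (T : CertTablesA K) : ℕ := (T.Ka + T.Kb + 1).toNat

/-- Number of window coordinates. [folklore] -/
def n (T : CertTablesA K) : ℕ := 4 * T.m

/-- Window coordinate of `(i, k)`. [folklore] -/
def idx (T : CertTablesA K) (i : Fin 4) (k : ℤ) : ℕ := i.val * T.m + (k + T.Kb).toNat

/-- Default stage record. [folklore] -/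
def stageDefault : StageTablesA K :=
  { S := 0, ω := #[], bb := 0, κ := 0, Λ := 0, δ := 0, Lv := 0, as := 0, γ := 0, Nσ := 0, lev := 0, dm := 0, ΛX := 0,
    nx := 0, ell := #[], ctr := #[], rad := #[], s := #[], β := #[], NDL := #[], σf := #[], nodes := #[], steps := #[] }

/-- Default node record. [folklore] -/
def nodeDefault : NodeTablesA K :=
  { Tn := 0, mC := 0, EI := 0, E := 0, EO := 0, ρ := 0, ρO := 0, NCi := 0, x := #[], P := #[], rP := #[], Cm := #[],
    Ci := #[], W := #[] }

/-- Stage record (junk default beyond the array). [folklore] -/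
def stage (T : CertTablesA K) (j : ℕ) : StageTablesA K := T.stages.getD j stageDefault

/-- Node record. [folklore] -/
def node (T : CertTablesA K) (j s : ℕ) : NodeTablesA K := (T.stage j).nodes.getD s nodeDefault

/-- Sub-step record. [folklore] -/
def step (T : CertTablesA K) (j s : ℕ) : StepTables K :=
  (T.stage j).steps.getD s { h := 0, mT := 0, SpO := 0, Sp := 0, SpI := 0, L1 := 0, NV := 0, NVh := 0, dP := 0, κB := 0 }

/-- Weight of window coordinate `c` at stage `j`. [folklore] -/
def wgt (T : CertTablesA K) (j c : ℕ) : K := vgetA (T.stage j).ω (c % T.m)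

/-- Effective coefficient look-up, O(1). [folklore] -/
def coefAt (T : CertTablesA K) (i₁ i₂ i : Fin 4) (μi : ℕ) (k : ℤ) : K :=
  vgetA T.coef ((((i₁.val * 4 + i₂.val) * 4 + i.val) * 4 + μi) * T.m + (k + T.Kb).toNat)

/-- Window component of an array-coded vector, zero off the window. [folklore] -/
def comp (T : CertTablesA K) (y : Array K) (i : Fin 4) (k : ℤ) : K :=
  if -T.Kb ≤ k ∧ k ≤ T.Ka then vgetA y (T.idx i k) else 0

/-- The truncated field in window coordinates (target `(i, k)`), array-coded. [folklore] -/
def qTK (T : CertTablesA K) (y : Array K) (i : Fin 4) (k : ℤ) : K :=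
  sumN 4 fun a => sumN 4 fun b => sumN 4 fun μi =>
    let μ := CertTables.shifts.getD μi (0, 0, 0)
    T.coefAt ⟨a % 4, Nat.mod_lt _ (by omega)⟩ ⟨b % 4, Nat.mod_lt _ (by omega)⟩ i μi k *
      (T.comp y ⟨a % 4, Nat.mod_lt _ (by omega)⟩ (k - μ.2.2 + μ.1) *
        T.comp y ⟨b % 4, Nat.mod_lt _ (by omega)⟩ (k - μ.2.2 + μ.2.1))

/-- `qT` as an array-coded vector. [folklore] -/
def qTvec (T : CertTablesA K) (y : Array K) : Array K :=
  Array.ofFn (n := T.n) fun c => T.qTK y ⟨(c.val / T.m) % 4, Nat.mod_lt _ (by omega)⟩ ((c.val % T.m : ℕ) - T.Kb)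

/-- The polarised field, array-coded. [folklore] -/
def QbVec (T : CertTablesA K) (u v : Array K) : Array K :=
  let quv := T.qTvec (addVecA T.n u v)
  let qu := T.qTvec u
  let qv := T.qTvec v
  Array.ofFn (n := T.n) fun c => (vgetA quv c - vgetA qu c - vgetA qv c) / 2

/-- Coordinate vector `e_c`, array-coded. [folklore] -/
def basisVec (T : CertTablesA K) (c : ℕ) : Array K := Array.ofFn (n := T.n) fun c' => if c'.val = c then 1 else 0

/-- Matrix of `v ↦ Qb(a, v) + Qb(v, a)`, array-coded (same algorithm as the list version). [folklore] -/
def symQbMat (T : CertTablesA K) (a : Array K) : Array (Array K) :=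
  let cols : Array (Array K) := Array.ofFn (n := T.n) fun c =>
    addVecA T.n (T.QbVec a (T.basisVec c.val)) (T.QbVec (T.basisVec c.val) a)
  Array.ofFn (n := T.n) fun r => Array.ofFn (n := T.n) fun c => vgetA (cols.getD c.val #[]) r

/-- Identity matrix, array-coded. [folklore] -/
def idMat (T : CertTablesA K) : Array (Array K) :=
  Array.ofFn (n := T.n) fun r => Array.ofFn (n := T.n) fun c => if r.val = c.val then 1 else 0

/-- `Rem`, exactly (as `CertTables.RemK`). [folklore] -/
def RemK (T : CertTablesA K) (b mC u : K) : K := mC * (b * mC * u) ^ (T.pdeg + 1) / (1 - b * mC * u)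

/-- `RemV`, exactly. [folklore] -/
def RemVK (T : CertTablesA K) (b mC u : K) : K :=
  ((((T.pdeg : ℕ) : K) + 2) * (b * mC * u) ^ (T.pdeg + 1) - (((T.pdeg : ℕ) : K) + 1) * (b * mC * u) ^ (T.pdeg + 2)) /
    (1 - b * mC * u) ^ 2

/-! ### Array-coded checkers (mirror `checkNode` / `checkStep` / `checkChainStage` / `checkChain` clause by clause) -/

/-- Weighted row-sum test. [folklore] -/
def rowSumLe (T : CertTablesA K) (A : Array (Array K)) (wIn bound : ℕ → K) : Bool :=
  allN T.n fun r => decide (sumN T.n (fun c => |mgetA A r c| * wIn c) ≤ bound r)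

/-- Equality of the first `n` entries. [folklore] -/
def vecEq (T : CertTablesA K) (u v : Array K) : Bool := allN T.n fun c => decide (vgetA u c = vgetA v c)

/-- Equality on `n × n`. [folklore] -/
def matEq (T : CertTablesA K) (A B : Array (Array K)) : Bool :=
  allN T.n fun r => allN T.n fun c => decide (mgetA A r c = mgetA B r c)

/-- NODE CHECK, array-coded (clauses as `CertTables.checkNode`). [folklore] -/
def checkNode (T : CertTablesA K) (j s : ℕ) : Bool :=
  let N := T.node j s
  let w : ℕ → K := T.wgt j
  decide (0 ≤ N.mC) && allN T.n (fun c => decide (|vgetA N.x c| ≤ N.mC * w c)) &&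
  allN T.n (fun c => decide (0 ≤ vgetA N.rP c)) &&
  decide (0 ≤ N.EI) && decide (N.EI ≤ N.E) && decide (N.E ≤ N.EO) && decide (N.EO ≤ N.ρO) &&
  decide (N.E ≤ N.ρ) && decide (N.ρ ≤ N.ρO) &&
  T.matEq (mulMatA T.n N.Ci N.Cm) T.idMat && T.matEq (mulMatA T.n N.Cm N.Ci) T.idMat &&
  T.rowSumLe N.Cm (vgetA N.rP) (fun r => (N.ρ - N.E) * w r) &&
  T.rowSumLe N.Cm (vgetA N.rP) (fun r => (N.ρO - N.EO) * w r) &&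
  decide (0 ≤ N.NCi) && T.rowSumLe N.Ci w (fun r => N.NCi * vgetA N.rP r) &&
  T.vecEq (N.P.getD 0 #[]) N.x &&
  allN T.pdeg (fun q => T.vecEq (Array.ofFn (n := T.n) fun c => (((q : ℕ) : K) + 1) * vgetA (N.P.getD (q + 1) #[]) c.val)
    ((List.range (q + 1)).foldr (fun m' acc => addVecA T.n (T.QbVec (N.P.getD m' #[]) (N.P.getD (q - m') #[])) acc)
      (zeroVecA T.n))) &&
  T.matEq (N.W.getD 0 #[]) T.idMat &&
  allN T.pdeg (fun q => T.matEq (smulMatA T.n (((q : ℕ) : K) + 1) (N.W.getD (q + 1) #[]))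
    ((List.range (q + 1)).foldr (fun m' acc => addMatA T.n (mulMatA T.n (T.symQbMat (N.P.getD m' #[])) (N.W.getD (q - m') #[]))
      acc) (zeroMatA T.n)))

/-- `Σ_n h^n |P n|_c`. [folklore] -/
def tpAbs (T : CertTablesA K) (N : NodeTablesA K) (h : K) (c : ℕ) : K :=
  sumN (T.pdeg + 1) fun q => |vgetA (N.P.getD q #[]) c| * h ^ q

/-- `Σ_n h^n W_n` as one matrix. [folklore] -/
def vapMat (T : CertTablesA K) (N : NodeTablesA K) (h : K) : Array (Array K) :=
  (List.range (T.pdeg + 1)).foldr (fun q acc => addMatA T.n (smulMatA T.n (h ^ q) (N.W.getD q #[])) acc) (zeroMatA T.n)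

/-- Weighted operator-norm test. [folklore] -/
def opNormLe (T : CertTablesA K) (j : ℕ) (A : Array (Array K)) (N : K) : Bool :=
  T.rowSumLe A (T.wgt j) (fun r => N * T.wgt j r)

/-- SUB-STEP CHECK, array-coded (clauses as `CertTables.checkStep`). [folklore] -/
def checkStep (T : CertTablesA K) (j s : ℕ) : Bool :=
  let G := T.stage j
  let N := T.node j s
  let N' := T.node j (s + 1)
  let St := T.step j s
  let w : ℕ → K := T.wgt j
  let q : K := G.bb * N.mC * St.h
  let qO : K := G.bb * (N.mC + N.ρO) * St.h
  let qκ : K := G.bb * (St.mT + St.SpO + G.κ) * St.h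
  let remh : K := T.RemK G.bb N.mC St.h
  let remVh : K := T.RemVK G.bb N.mC St.h
  decide (0 < St.h) && decide (q < 1) && decide (qO < 1) && decide (N'.Tn = N.Tn + St.h) &&
  allN T.n (fun c => decide (T.tpAbs N St.h c ≤ St.mT * w c)) && decide (0 ≤ St.SpO) &&
  decide (qκ < 1) && decide (1 ≤ St.L1 * (1 - qκ) ^ 2) &&
  decide (0 ≤ St.NV) &&
  allN T.n (fun r => decide (sumN (T.pdeg + 1) (fun q' => St.h ^ q' *
    sumN T.n (fun c => |mgetA (N.W.getD q' #[]) r c| * w c)) ≤ St.NV * w r)) &&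
  T.opNormLe j (T.vapMat N St.h) St.NVh &&
  decide (0 ≤ St.NVh) &&
  allN T.n (fun c => decide (|sumN (T.pdeg + 1) (fun q' => vgetA (N.P.getD q' #[]) c * St.h ^ q') - vgetA N'.x c| ≤
    St.dP * w c)) &&
  decide (St.NV * N.EI + remh + remVh * N.EI + CertTables.DevK G.bb N.mC N.EI St.h ≤ St.SpI) &&
  decide (St.NV * N.ρ + remh + remVh * N.ρ + CertTables.DevK G.bb N.mC N.ρ St.h ≤ St.Sp) &&
  decide (St.NV * N.ρO + remh + remVh * N.ρO + CertTables.DevK G.bb N.mC N.ρO St.h + St.L1 * G.κ ≤ St.SpO) &&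
  decide (St.dP + St.NVh * N.EI + remh + remVh * N.EI + CertTables.DevK G.bb N.mC N.EI St.h ≤ N'.EI) &&
  decide (St.dP + St.NVh * N.E + remh + remVh * N.ρ + CertTables.DevK G.bb N.mC N.ρ St.h ≤ N'.E) &&
  decide (St.dP + St.NVh * N.EO + remh + remVh * N.ρO + CertTables.DevK G.bb N.mC N.ρO St.h ≤ N'.EO) &&
  decide (N'.E + St.L1 * G.κ ≤ N'.EO) &&
  T.rowSumLe (mulMatA T.n N'.Ci (mulMatA T.n (T.vapMat N St.h) N.Cm)) (vgetA N.rP) (vgetA N'.rP) &&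
  decide (N'.NCi * (remVh + (1 / (1 - qO) ^ 2 - 1 / (1 - q) ^ 2)) * (N.ρO - N.EO) ≤ St.κB) &&
  allN T.n (fun c => decide (T.tpAbs N St.h c + St.SpO * w c ≤
    vgetA T.M (c % T.m + 1) - G.Λ * G.δ * T.τs * w c - T.mm))

/-- STAGE CHECK, array-coded. [folklore] -/
def checkChainStage (T : CertTablesA K) (j : ℕ) : Bool :=
  let G := T.stage j
  decide (1 ≤ G.S) && decide ((T.node j 0).Tn = 0) && decide ((T.node j G.S).Tn ≤ T.τs) &&
  decide ((T.node j 0).EI = 0) &&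
  allN G.ell.size (fun l =>
    decide (|sumN T.n (fun c => vgetA (G.ell.getD l #[]) c * vgetA (T.node j 0).x c) - vgetA G.ctr l| ≤ vgetA G.rad l)) &&
  allN (G.S + 1) (fun s => T.checkNode j s) && allN G.S (fun s => T.checkStep j s)

/-- CHAIN CHECK, array-coded. [folklore] -/
def checkChain (T : CertTablesA K) : Bool := allN (T.N₀ + 1) fun j => T.checkChainStage j

end CertTablesA

/-! ### The compact input expanded with ARRAY jets -/

namespace CertTablesC

variable {K : Type} [Field K] [LinearOrder K]

/-- The global block as a `CertTablesA` with no stages. [folklore] -/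
def skeletonA (C : CertTablesC K) : CertTablesA K :=
  { Kb := C.Kb, Ka := C.Ka, pdeg := C.pdeg, N₀ := C.N₀, R := C.R, θ := C.θ, c := C.c, η₀ := C.η₀, Cb := C.Cb, Cg := C.Cg,
    τs := C.τs, mm := C.mm, i₀ := C.i₀, X₀ := C.X₀.toArray, M := C.M.toArray, W := C.W.toArray, α := C.α.toArray,
    coef := C.coef.toArray, stages := #[] }

/-- Taylor jets `[P 0, …, P pdeg]` by the exact recursion, array-coded. [folklore] -/
def jetsPA (G : CertTablesA K) (pdeg : ℕ) (x : Array K) : Array (Array K) :=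
  (List.range pdeg).foldl (fun acc q =>
    acc.push (Array.ofFn (n := G.n) fun c => (1 / (((q : ℕ) : K) + 1)) *
      vgetA ((List.range (q + 1)).foldr (fun m' s => addVecA G.n (G.QbVec (acc.getD m' #[]) (acc.getD (q - m') #[])) s)
        (zeroVecA G.n)) c.val)) #[x]

/-- Variational jets `[W 0, …, W pdeg]`, array-coded. [folklore] -/
def jetsWA (G : CertTablesA K) (pdeg : ℕ) (P : Array (Array K)) : Array (Array (Array K)) :=
  (List.range pdeg).foldl (fun acc q =>
    acc.push (smulMatA G.n (1 / (((q : ℕ) : K) + 1))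
      ((List.range (q + 1)).foldr (fun m' s => addMatA G.n (mulMatA G.n (G.symQbMat (P.getD m' #[])) (acc.getD (q - m') #[]))
        s) (zeroMatA G.n)))) #[G.idMat]

/-- Expansion of a compact node with array jets. [folklore] -/
def expandNodeA (G : CertTablesA K) (pdeg : ℕ) (frames : Array (Array (Array K) × Array (Array K))) (N : NodeTablesC K) :
    NodeTablesA K :=
  let P := jetsPA G pdeg N.x.toArray
  { Tn := N.Tn, mC := N.mC, EI := N.EI, E := N.E, EO := N.EO, ρ := N.ρ, ρO := N.ρO, NCi := N.NCi, x := N.x.toArray,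
    P := P, rP := N.rP.toArray, Cm := (frames.getD N.fr (#[], #[])).1, Ci := (frames.getD N.fr (#[], #[])).2,
    W := jetsWA G pdeg P }

/-- Expansion of a compact stage with array jets. [folklore] -/
def expandStageA (G : CertTablesA K) (pdeg : ℕ) (St : StageTablesC K) : StageTablesA K :=
  let frames : Array (Array (Array K) × Array (Array K)) :=
    (St.frames.map fun fr => ((fr.1.map List.toArray).toArray, (fr.2.map List.toArray).toArray)).toArray
  { S := St.S, ω := St.ω.toArray, bb := St.bb, κ := St.κ, Λ := St.Λ, δ := St.δ, Lv := St.Lv, as := St.as, γ := St.γ,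
    Nσ := St.Nσ, lev := St.lev, dm := St.dm, ΛX := St.ΛX, nx := St.nx, ell := (St.ell.map List.toArray).toArray,
    ctr := St.ctr.toArray, rad := St.rad.toArray, s := St.s.toArray, β := St.β.toArray, NDL := St.NDL.toArray,
    σf := St.σf.toArray, nodes := (St.nodes.map (expandNodeA G pdeg frames)).toArray, steps := St.steps.toArray }

/-- **The compact input expanded into array-coded tables** (compiled replay path). [folklore] -/
def expandA (C : CertTablesC K) : CertTablesA K :=
  { C.skeletonA with stages := (C.stages.map (expandStageA C.skeletonA C.pdeg)).toArray }

end CertTablesC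

/-- The array-coded expansion of the compact toy has the toy's `n = 8` window coordinates (evaluation of the checkers at
size is by compiled replay — see the companion timing file; kernel `decide` is NOT the intended evaluator here). [folklore] -/
example : toy3.expandA.n = 8 := by decide

end Summit.NavierStokesRegularity.NavierStokesRegularity.Theorems.TaylorModelCert
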